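import Literature.AlgebraicGeometry.Morphisms.FormalFunctions
import Literature.AlgebraicGeometry.Motives.GoodReductionSpecialFibreProofs
import Mathlib.AlgebraicGeometry.Morphisms.ClosedImmersion
import Mathlib.AlgebraicGeometry.Morphisms.QuasiCompact
import Mathlib.AlgebraicGeometry.Morphisms.Flat
import Mathlib.AlgebraicGeometry.Geometrically.Connected
import Mathlib.AlgebraicGeometry.Noetherian
import Mathlib.RingTheory.Henselian
import Mathlib.Algebra.Polynomial.Identities
import Mathlib.RingTheory.AdicCompletion.Basic
import Mathlib.RingTheory.Noetherian.Nilpotent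
import Mathlib.Topology.Sheaves.CommRingCat
import Mathlib.FieldTheory.Perfect
import Mathlib.FieldTheory.Minpoly.Field

/-!
# The special fibre of a smooth proper model, from the theorem on formal functions

Sibling proofs file of `Literature/AlgebraicGeometry/Motives/GoodReduction.lean` (named fact
`Literature.AlgebraicGeometry.Motives.IntegralModel.geometricallyIrreducible_reductionAt`: the reduction `𝒳 ×_{𝓞_{K,v}} κ(v)` of a
smooth proper model `𝒳 → Spec 𝓞_{K,v}` of a smooth projective geometrically irreducible `X/K`
is geometrically irreducible) and of `Literature/AlgebraicGeometry/Morphisms/FormalFunctions.lean`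
(the theorem on formal functions for `H⁰`, The Stacks Project, Tag 02OC = Cohomology of Schemes,
Theorem 30.20.5, case `p = 0`, `𝓕 = 𝒪_X`, spelled out there as the predicates
`HasSurjectiveFormalFunctions I f` / `HasInjectiveFormalFunctions I f` on the data `(A, I, f)`).

Main result: `Literature.AlgebraicGeometry.Motives.IntegralModel.geometricallyIrreducible_reductionAt_of_hasSurjectiveFormalFunctions
(hFF : HasSurjectiveFormalFunctions 𝔪_v (𝒳 → Spec 𝓞_{K,v})) : 𝒳.geometricallyIrreducible_reductionAt`,
which only consumes the surjectivity of `Γ(𝒳, 𝒪)^∧ → lim_n Γ(𝒳_n, 𝒪)` for the one model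
`𝒳 → Spec 𝓞_{K,v}` and the ideal `𝔪_v`. This
pushes the single input of the fact one level down the printed proofs: the earlier
conditional discharges (`GoodReductionSpecialFibreProofs.lean`) assumed Zariski's connectedness
theorem (Stacks Project, Tags 03H2/0AY8), whose printed proof in the Noetherian case (Tag 03H0 =
More on Morphisms, Theorem 37.53.4) consists of the theorem on formal functions plus an
idempotent-lifting argument; here that argument (and everything else) is carried out in Lean.

## The argument (Stacks Project, proof of Theorem 37.53.4, with Hensel's lemma for idempotents)

Let `A` be Noetherian, `q : A → k₀` surjective with kernel `I`, `f : X → Spec A` proper with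
`A → Γ(X, 𝒪_X)` bijective, `X₀ = X ×_A k₀` the closed fibre and `X_n = X ×_A A/I^{n+1}` its
infinitesimal neighbourhoods (`FormalFunctions.lean`).
* `existsUnique_isRoot_of_isClosedImmersion` (**Hensel's lemma along a surjective closed
  immersion** `σ : Z₀ → Z`, `Z` locally Noetherian and quasi-compact): a simple root
  `θ ∈ Γ(Z₀, 𝒪)` of the pull-back of a monic `F ∈ Γ(Z, 𝒪)[T]` lifts uniquely to a root of `F` in
  `Γ(Z, 𝒪)`. Locally on affine opens `W` this is Hensel's lemma (Mathlib `HenselianRing`, via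
  `IsAdicComplete`) in the Noetherian ring `Γ(Z, W)`, complete for its nilpotent nilradical,
  which contains `ker (Γ(Z, W) → Γ(Z₀, σ⁻¹W))` because `σ` is surjective
  (`isNilpotent_of_app_eq_zero`); local roots are unique (`eq_of_isRoot_of_isNilpotent_sub`:
  Taylor expansion) and glue (sheaf condition).
* `mem_range_algebraMapΓ_of_isRoot`: applied to `σ_n : X₀ → X_n` (a surjective closed immersion,
  `isPullback_toInfinitesimalNeighbourhood`), a simple root `θ ∈ Γ(X₀, 𝒪)` of a monic
  `F ∈ k₀[T]` lifts compatibly to all `X_n`; by `HasSurjectiveFormalFunctions I f` the lifts come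
  from an `I`-adic Cauchy sequence in `Γ(X, 𝒪_X) = A`, so `θ = q(a)` is constant.
* `preconnectedSpace_pullback_of_hasSurjectiveFormalFunctions` (**Zariski's connectedness
  theorem**, connected form): under these hypotheses the closed fibre `X₀` is preconnected
  (idempotents are the simple roots of `T² - T`; this is how the Stacks Project concludes).
  `surjective_algebraMapΓ_snd_of_isReduced` / `isIso_appTop_snd_of_isReduced` /
  `geometricallyConnected_snd_of_isReduced`: if moreover `k₀` is perfect and `X₀` is reduced, then
  every function on `X₀` is a simple root of its minimal polynomial
  (`isUnit_aeval_derivative_minpoly`), so `H⁰(X₀, 𝒪) = k₀` and `X₀ → Spec k₀` is geometrically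
  connected (`geometricallyConnected_of_isIso_appTop` below).
* For the model (`Literature.AlgebraicGeometry.Motives.IntegralModel.isIso_appTop_reductionAt`): `Γ(𝒳, 𝒪) = 𝓞_{K,v}`
  (`bijective_appTop_of_genericFibre`: global functions are integral over `𝓞_{K,v}` by Mathlib's
  `isIntegral_appTop_of_universallyClosed`, and `𝓞_{K,v}` is integrally closed in `Γ(𝒳, 𝒪)` by
  the generic-fibre argument of `GoodReductionSpecialFibreProofs.lean`); `Λ = Γ(𝒳_v, 𝒪)` is
  reduced (smoothness) and integral over the finite, hence perfect, field `κ(v)`, so every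
  `x ∈ Λ` is a simple root of its minimal polynomial (`isUnit_aeval_derivative_minpoly`), hence
  constant: `κ(v) → Γ(𝒳_v, 𝒪)` is an isomorphism.
* `geometricallyConnected_of_isIso_appTop`: `H⁰(Y, 𝒪) = k` implies `Y → Spec k` geometrically
  connected, by flat base change of `H⁰` (Mathlib
  `isIso_pushoutSection_of_isQuasiSeparated_of_flat_right`; Stacks Project, Tag 02KH) and
  "no non-trivial idempotent functions ⇒ connected" (`preconnectedSpace_of_isIdempotentElem`).
* Smooth and geometrically connected over a field implies geometrically irreducible
  (`geometricallyIrreducible_of_geometricallyConnected_of_smoothOfRelativeDimension`, tree).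

The hypothesis `HasSurjectiveFormalFunctions 𝔪_v (𝒳 → Spec 𝓞_{K,v})` for the smooth proper model
itself would follow from the finiteness of coherent cohomology under proper morphisms (Stacks
Project, Tag 02O5) — for `𝒳` flat over the discrete valuation ring `𝓞_{K,v}` already from the
finiteness of `H¹(𝒳, 𝒪_𝒳)` (`Literature/AlgebraicGeometry/Morphisms/FormalFunctionsCechProofs.lean`,
`hasSurjectiveFormalFunctions_of_finite_cechH1`) — which Mathlib does not have for proper,
non-projective schemes. The UNCONDITIONAL discharge `geometricallyIrreducible_reductionAt_holds`
(`Literature/AlgebraicGeometry/Motives/GoodReductionZariskiProofs.lean`) therefore runs the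
Hensel-lifting argument of this file (`mem_range_algebraMapΓ_of_isRoot`,
`geometricallyConnected_of_isIso_appTop`) on a projective Chow cover `Z → 𝒳` instead, for which
`HasSurjectiveFormalFunctions 𝔪_v (Z → Spec 𝓞_{K,v})` is proved (Serre's finiteness of
`Ȟ¹(Z, 𝒪_Z)`, `Morphisms.ProjCech.moduleFinite_cechH1`). No closed named fact for Tag 02OC is used
or recorded: the theorem on formal functions enters only through the predicate
`HasSurjectiveFormalFunctions`, instance by instance.

## References

* The Stacks Project, Tag 02OC (Cohomology of Schemes, Theorem 30.20.5); Tag 03H0 (More on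
  Morphisms, Theorem 37.53.4) and its proof; Tag 0AY8 (Lemma 37.53.6); Tag 02KH (Cohomology of
  Schemes, Lemma 30.5.2); Tag 056T (Varieties, Lemma 33.25.4).
* A. Grothendieck, EGA III₁, Théorème 4.1.5 and §4.3 (Zariski's connectedness theorem).
* R. Hartshorne, *Algebraic Geometry*, III.11.1–III.11.3.
-/

noncomputable section

open CategoryTheory AlgebraicGeometry Limits Polynomial TopologicalSpace Opposite

universe u

namespace Literature.AlgebraicGeometry.Motives

/-! ### Algebra: simple roots modulo nilpotents -/

/-- A simple root of a polynomial is the only root in its nilpotent neighbourhood: if `F(x) = 0`,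
`F'(x)` is a unit, `F(y) = 0` and `y - x` is nilpotent, then `y = x` (Taylor expansion
`F(y) = F(x) + F'(x)(y - x) + k (y - x)²`). [folklore] -/
theorem eq_of_isRoot_of_isNilpotent_sub {R : Type*} [CommRing R] (F : R[X]) {x y : R}
    (hx : F.IsRoot x) (hy : F.IsRoot y) (hu : IsUnit (F.derivative.eval x))
    (hn : IsNilpotent (y - x)) : y = x := by
  obtain ⟨k, hk⟩ := F.binomExpansion x (y - x)
  rw [add_sub_cancel, hy.eq_zero, hx.eq_zero, zero_add] at hk
  have h1 : (F.derivative.eval x + k * (y - x)) * (y - x) = 0 := by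
    rw [add_mul, mul_assoc, ← pow_two]; exact hk.symm
  have hu' : IsUnit (F.derivative.eval x + k * (y - x)) :=
    ((Commute.all k (y - x)).isNilpotent_mul_left hn).isUnit_add_left_of_commute hu
      (Commute.all _ _)
  exact sub_eq_zero.mp ((hu'.mul_right_eq_zero).mp h1)

/-- A ring is adically complete with respect to a nilpotent ideal. [folklore] -/
theorem isAdicComplete_of_isNilpotent {R : Type*} [CommRing R] (I : Ideal R)
    (hI : IsNilpotent I) : IsAdicComplete I R := by
  obtain ⟨N, hN⟩ := hI
  have hbot : ∀ n, N ≤ n → (I ^ n • ⊤ : Submodule R R) = ⊥ := fun n hn ↦ by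
    rw [smul_eq_mul, Ideal.mul_top]
    exact pow_eq_zero_of_le hn hN
  haveI : IsHausdorff I R := ⟨fun x hx ↦ by
    have := hx N
    rwa [hbot N le_rfl, SModEq.bot] at this⟩
  haveI : IsPrecomplete I R := ⟨fun f hf ↦ ⟨f N, fun n ↦ by
    rcases le_total n N with hn | hn
    · exact hf hn
    · have := hf hn
      rw [hbot N le_rfl, SModEq.bot] at this
      rw [this]⟩⟩
  exact ⟨⟩

/-! ### Functions and units under a surjective morphism -/

section Surjective

variable {Z₀ Z : Scheme.{u}} (σ : Z₀ ⟶ Z) [Surjective σ]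

/-- If `σ : Z₀ → Z` is surjective and the pull-back of a function `s` on `U ⊆ Z` vanishes, then
the non-vanishing locus of `s` is empty. [folklore] -/
theorem basicOpen_eq_bot_of_app_eq_zero {U : Z.Opens} (s : Γ(Z, U)) (hs : σ.app U s = 0) :
    Z.basicOpen s = ⊥ := by
  have h : σ ⁻¹ᵁ (Z.basicOpen s) = ⊥ := by
    rw [Scheme.preimage_basicOpen, hs, Scheme.basicOpen_zero]
  ext x
  simp only [Opens.coe_bot, Set.mem_empty_iff_false, iff_false]
  intro hx
  obtain ⟨y, rfl⟩ := σ.surjective x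
  have : y ∈ σ ⁻¹ᵁ (Z.basicOpen s) := hx
  rw [h] at this
  exact this

/-- If `σ : Z₀ → Z` is surjective, a function on a quasi-compact open of `Z` whose pull-back to
`Z₀` vanishes is nilpotent. [folklore] -/
theorem isNilpotent_of_app_eq_zero {U : Z.Opens} (hU : IsCompact (U : Set Z)) (s : Γ(Z, U))
    (hs : σ.app U s = 0) : IsNilpotent s :=
  (Scheme.isNilpotent_iff_basicOpen_eq_bot_of_isCompact hU s).mpr
    (basicOpen_eq_bot_of_app_eq_zero σ s hs)

/-- If `σ : Z₀ → Z` is surjective, a function on `Z` whose pull-back to `Z₀` is a unit is a unit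
(units are detected on stalks, i.e. pointwise). [folklore] -/
theorem isUnit_of_isUnit_app {U : Z.Opens} (s : Γ(Z, U)) (hs : IsUnit (σ.app U s)) :
    IsUnit s := by
  refine Z.toRingedSpace.isUnit_of_isUnit_germ U s fun x hx ↦ ?_
  obtain ⟨y, rfl⟩ := σ.surjective x
  have hy : y ∈ Z₀.basicOpen (σ.app U s) := by
    rw [Z₀.basicOpen_of_isUnit hs]; exact hx
  rw [← Scheme.preimage_basicOpen] at hy
  exact (Z.mem_basicOpen s (σ.base y) hx).mp hy

end Surjective

/-! ### Hensel's lemma along a surjective closed immersion (nilpotent thickening) -/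

section Hensel

variable {Z₀ Z : Scheme.{u}} (σ : Z₀ ⟶ Z)

variable (F : Γ(Z, ⊤)[X]) (θ : Γ(Z₀, ⊤))

/-! A *local lift* of `θ` on an open `W ⊆ Z` is a root `y` of `F|_W` whose pull-back to
`σ⁻¹ W ⊆ Z₀` is `θ|_{σ⁻¹ W}`, i.e.
`(F.map (resTop Z W)).IsRoot y ∧ σ.app W y = resTop Z₀ (σ ⁻¹ᵁ W) θ`. -/

variable {σ F θ}

/-- Local lifts restrict to local lifts. [folklore] -/
theorem localLift_restrict {W W' : Z.Opens} (h : W' ≤ W) {y : Γ(Z, W)}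
    (hy : (F.map (Morphisms.resTop Z W)).IsRoot y ∧ σ.app W y = Morphisms.resTop Z₀ (σ ⁻¹ᵁ W) θ) :
    (F.map (Morphisms.resTop Z W')).IsRoot (Z.presheaf.map (homOfLE h).op y) ∧
      σ.app W' (Z.presheaf.map (homOfLE h).op y) = Morphisms.resTop Z₀ (σ ⁻¹ᵁ W') θ := by
  constructor
  · have := hy.1
    rw [IsRoot.def] at this ⊢
    have e : (F.map (Morphisms.resTop Z W')) =
        (F.map (Morphisms.resTop Z W)).map (Z.presheaf.map (homOfLE h).op).hom := by
      rw [Polynomial.map_map]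
      congr 1
      ext s
      exact (Morphisms.map_resTop h s).symm
    rw [e, eval_map, eval₂_hom, this, map_zero]
  · change (Z.presheaf.map (homOfLE h).op ≫ σ.app W') y = _
    rw [σ.naturality]
    change Z₀.presheaf.map _ (σ.app W y) = _
    rw [hy.2]
    exact Morphisms.map_resTop (Z := Z₀) (σ.preimage_mono h) θ

variable [Surjective σ]

/-- Uniqueness of local lifts on quasi-compact opens, for `σ` surjective: two local lifts differ
by a function vanishing on `Z₀`, i.e. a nilpotent, and `F'` is a unit at a lift (it is after
pull-back to `Z₀`), so `eq_of_isRoot_of_isNilpotent_sub` applies. [folklore] -/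
theorem localLift_unique (hθ' : IsUnit ((F.map σ.appTop.hom).derivative.eval θ))
    {W : Z.Opens} (hW : IsCompact (W : Set Z)) {y y' : Γ(Z, W)}
    (hy : (F.map (Morphisms.resTop Z W)).IsRoot y ∧ σ.app W y = Morphisms.resTop Z₀ (σ ⁻¹ᵁ W) θ)
    (hy' : (F.map (Morphisms.resTop Z W)).IsRoot y' ∧ σ.app W y' = Morphisms.resTop Z₀ (σ ⁻¹ᵁ W) θ) : y' = y := by
  refine eq_of_isRoot_of_isNilpotent_sub (F.map (Morphisms.resTop Z W)) hy.1 hy'.1 ?_ ?_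
  · -- `F_W'(y)` pulls back to the unit `(F^σ)'(θ)|_{σ⁻¹ W}`
    refine isUnit_of_isUnit_app σ _ ?_
    have hL : σ.app W ((F.map (Morphisms.resTop Z W)).derivative.eval y) =
        (F.derivative.map ((σ.app W).hom.comp (Morphisms.resTop Z W))).eval (σ.app W y) := by
      rw [Polynomial.derivative_map, ← Polynomial.map_map]
      conv_rhs => rw [eval_map, eval₂_hom]
    have hR : Morphisms.resTop Z₀ (σ ⁻¹ᵁ W) ((F.map σ.appTop.hom).derivative.eval θ) =
        (F.derivative.map ((Morphisms.resTop Z₀ (σ ⁻¹ᵁ W)).comp σ.appTop.hom)).eval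
          (Morphisms.resTop Z₀ (σ ⁻¹ᵁ W) θ) := by
      rw [Polynomial.derivative_map, ← Polynomial.map_map]
      conv_rhs => rw [eval_map, eval₂_hom]
    have hc : (σ.app W).hom.comp (Morphisms.resTop Z W) = (Morphisms.resTop Z₀ (σ ⁻¹ᵁ W)).comp σ.appTop.hom := by
      ext s
      exact Morphisms.app_resTop σ W s
    rw [hL, hy.2, hc, ← hR]
    exact hθ'.map _
  · refine isNilpotent_of_app_eq_zero σ hW _ ?_
    rw [map_sub, hy.2, hy'.2, sub_self]

/-- Existence of local lifts on affine opens `W`, for `σ` a surjective closed immersion into a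
locally Noetherian `Z`: Hensel's lemma (Mathlib `HenselianRing.is_henselian`) in the Noetherian
ring `Γ(Z, W)`, which is adically complete for its nilpotent nilradical `N ⊇ ker (σ^*)`, applied
to any preimage `y₀` of `θ|_{σ⁻¹ W}` under the surjection `Γ(Z, W) → Γ(Z₀, σ⁻¹ W)`; the root
`y ≡ y₀ mod N` pulls back to a root of `F^σ` differing from `θ|_{σ⁻¹ W}` by a nilpotent, hence
equal to it. [folklore] -/
theorem exists_localLift [IsLocallyNoetherian Z] [IsClosedImmersion σ] (hF : F.Monic)
    (hθ : (F.map σ.appTop.hom).IsRoot θ)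
    (hθ' : IsUnit ((F.map σ.appTop.hom).derivative.eval θ))
    {W : Z.Opens} (hW : IsAffineOpen W) :
    ∃ y : Γ(Z, W), (F.map (Morphisms.resTop Z W)).IsRoot y ∧ σ.app W y = Morphisms.resTop Z₀ (σ ⁻¹ᵁ W) θ := by
  haveI : IsNoetherianRing Γ(Z, W) := IsLocallyNoetherian.component_noetherian ⟨W, hW⟩
  set N : Ideal Γ(Z, W) := nilradical Γ(Z, W) with hN
  haveI : IsAdicComplete N Γ(Z, W) :=
    isAdicComplete_of_isNilpotent N (IsNoetherianRing.isNilpotent_nilradical _)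
  set FW := F.map (Morphisms.resTop Z W) with hFW
  set θW := Morphisms.resTop Z₀ (σ ⁻¹ᵁ W) θ with hθW
  obtain ⟨y₀, hy₀⟩ := σ.app_surjective W hW θW
  -- the pull-back of `F_W` along `σ` is `F^σ|_{σ⁻¹ W}`
  have emap : FW.map (σ.app W).hom = (F.map σ.appTop.hom).map (Morphisms.resTop Z₀ (σ ⁻¹ᵁ W)) := by
    rw [hFW, Polynomial.map_map, Polynomial.map_map]
    congr 1
    ext s
    exact Morphisms.app_resTop σ W s
  have hroot : (FW.map (σ.app W).hom).IsRoot θW := by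
    rw [emap, IsRoot.def, hθW, eval_map, eval₂_hom, hθ.eq_zero, map_zero]
  have hunit : IsUnit ((FW.map (σ.app W).hom).derivative.eval θW) := by
    rw [emap, Polynomial.derivative_map, hθW, eval_map, eval₂_hom]
    exact hθ'.map _
  -- Hensel's hypotheses at `y₀`
  have h1 : FW.eval y₀ ∈ N := by
    refine isNilpotent_of_app_eq_zero σ hW.isCompact _ ?_
    rw [← eval₂_hom, ← eval_map, hy₀]
    exact hroot.eq_zero
  have h2u : IsUnit (FW.derivative.eval y₀) := by
    refine isUnit_of_isUnit_app σ _ ?_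
    rw [← eval₂_hom, ← eval_map, ← Polynomial.derivative_map, hy₀]
    exact hunit
  have h2 : IsUnit (Ideal.Quotient.mk N (FW.derivative.eval y₀)) := h2u.map _
  obtain ⟨y, hy, hyy₀⟩ := HenselianRing.is_henselian FW (hF.map _) y₀ h1 h2
  refine ⟨y, hy, ?_⟩
  -- `σ^* y` and `θ_W` are roots of `F_W^σ` differing by a nilpotent
  refine eq_of_isRoot_of_isNilpotent_sub (FW.map (σ.app W).hom) hroot ?_ hunit ?_
  · rw [IsRoot.def, eval_map, eval₂_hom, hy.eq_zero, map_zero]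
  · rw [← hy₀, ← map_sub]
    exact IsNilpotent.map (mem_nilradical.mp hyy₀) _

/-- **Hensel's lemma along a surjective closed immersion.** Let `σ : Z₀ → Z` be a surjective
closed immersion into a locally Noetherian quasi-compact scheme (e.g. the inclusion of a closed
subscheme with the same underlying space, such as the closed fibre into an infinitesimal
neighbourhood), `F` a monic polynomial with coefficients in `Γ(Z, 𝒪_Z)` and `θ ∈ Γ(Z₀, 𝒪_{Z₀})` a
simple root of its pull-back `F^σ` (`F^σ(θ) = 0`, `(F^σ)'(θ)` a unit). Then there is a unique root
`y ∈ Γ(Z, 𝒪_Z)` of `F` with `σ^* y = θ`. (Locally: Hensel's lemma in the Noetherian rings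
`Γ(Z, W)`, `W` affine, which are complete for their nilpotent nilradicals ⊇ `ker (σ^*)`; the local
roots are unique, as two of them differ by a nilpotent, hence glue.) [folklore] -/
theorem existsUnique_isRoot_of_isClosedImmersion [IsLocallyNoetherian Z] [CompactSpace Z]
    [IsClosedImmersion σ] (hF : F.Monic) (hθ : (F.map σ.appTop.hom).IsRoot θ)
    (hθ' : IsUnit ((F.map σ.appTop.hom).derivative.eval θ)) :
    ∃! y : Γ(Z, ⊤), F.IsRoot y ∧ σ.appTop y = θ := by
  haveI : IsNoetherian Z := ⟨⟩
  -- local lifts on the affine opens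
  choose yl hyl using fun W : Z.affineOpens ↦
    exists_localLift (σ := σ) hF hθ hθ' (W := W.1) W.2
  have hcompat :
      TopCat.Presheaf.IsCompatible Z.presheaf (fun W : Z.affineOpens ↦ (W : Z.Opens)) yl := by
    intro V W
    exact (localLift_unique hθ' (NoetherianSpace.isCompact _)
      (localLift_restrict inf_le_left (hyl V)) (localLift_restrict inf_le_right (hyl W))).symm
  obtain ⟨y, hy, hyu⟩ := Z.sheaf.existsUnique_gluing' (fun W : Z.affineOpens ↦ (W : Z.Opens)) ⊤
    (fun W ↦ homOfLE le_top) (by rw [iSup_affineOpens_eq_top]) yl hcompat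
  have hyW : ∀ W : Z.affineOpens, Morphisms.resTop Z W y = yl W := hy
  refine ⟨y, ⟨?_, ?_⟩, ?_⟩
  · rw [IsRoot.def]
    apply Z.sheaf.eq_of_locally_eq' (fun W : Z.affineOpens ↦ (W : Z.Opens)) ⊤
      (fun W ↦ homOfLE le_top) (by rw [iSup_affineOpens_eq_top])
    intro W
    change Morphisms.resTop Z W (F.eval y) = Morphisms.resTop Z W 0
    rw [map_zero, ← eval₂_hom, ← eval_map, hyW W]
    exact (hyl W).1
  · apply Z₀.sheaf.eq_of_locally_eq' (fun W : Z.affineOpens ↦ σ ⁻¹ᵁ (W : Z.Opens)) ⊤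
      (fun W ↦ homOfLE le_top)
      (by rw [← Scheme.Hom.preimage_iSup, iSup_affineOpens_eq_top]; exact le_top)
    intro W
    change Morphisms.resTop Z₀ (σ ⁻¹ᵁ W) (σ.appTop y) = Morphisms.resTop Z₀ (σ ⁻¹ᵁ W) θ
    rw [← Morphisms.app_resTop, hyW W]
    exact (hyl W).2
  · rintro y' ⟨h1, h2⟩
    refine hyu y' fun W ↦ ?_
    change Morphisms.resTop Z W y' = yl W
    refine localLift_unique hθ' (NoetherianSpace.isCompact _) (hyl W) ⟨?_, ?_⟩
    · rw [IsRoot.def, eval_map, eval₂_hom, h1.eq_zero, map_zero]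
    · rw [Morphisms.app_resTop, h2]

end Hensel

end Literature.AlgebraicGeometry.Motives

namespace Literature.AlgebraicGeometry.Motives

open Morphisms.infinitesimalNeighbourhood

/-! ### Simple roots on the closed fibre come from the base -/

section SimpleRoots

variable {A : Type u} [CommRing A] [IsNoetherianRing A] {X : Scheme.{u}} (f : X ⟶ Spec (.of A))
  [IsProper f] {k₀ : Type u} [CommRing k₀] (q : A →+* k₀)

/-- **Simple roots of polynomials over the base, in the ring of functions of the closed fibre of a
proper scheme with `Γ(X, 𝒪_X) = A`, are constant** (granting the surjectivity half of the
theorem on formal functions for `(A, I, f)`, Stacks Project, Tag 02OC, i.e.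
`HasSurjectiveFormalFunctions I f`). Let `A` be Noetherian, `q : A → k₀` surjective with kernel
`I`, `f : X → Spec A` proper with `A → Γ(X, 𝒪_X)` bijective, and `X₀ = X ×_A k₀` the closed
fibre. If
`θ ∈ Γ(X₀, 𝒪_{X₀})` is a simple root of a monic `F ∈ k₀[T]` (`F(θ) = 0`, `F'(θ)` a unit), then
`θ` is (the pull-back of) a constant `c ∈ k₀`. Proof (the idempotent-lifting argument of the
Stacks Project, proof of Theorem 37.53.4, Tag 03H0, run with Hensel's lemma instead of
idempotents): lift `F` to a monic `G ∈ A[T]`; by `existsUnique_isRoot_of_isClosedImmersion` `θ`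
lifts uniquely to a root `y_n` of `G` on each infinitesimal neighbourhood `X_n` (`X₀ → X_n` is a
surjective closed immersion), compatibly in `n` by uniqueness; by the theorem on formal functions
`(y_n)_n` comes from an `I`-adic Cauchy sequence in `Γ(X, 𝒪_X) = A`, whose `0`-th term `a ∈ A`
restricts to `θ = q(a)` on `X₀`. [cite: StacksProject, Tag 02OC (Cohomology of Schemes, Theorem 30.20.5) and Tag 03H0 (More on Morphisms, proof of Theorem 37.53.4)] -/
theorem mem_range_algebraMapΓ_of_isRoot
    (hFF : Morphisms.HasSurjectiveFormalFunctions (RingHom.ker q) f) (hq : Function.Surjective q)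
    (hΓ : Function.Bijective (Morphisms.algebraMapΓ f)) (F : k₀[X]) (hF : F.Monic)
    (θ : Γ(pullback f (Spec.map (CommRingCat.ofHom q)), ⊤))
    (hθ : (F.map (Morphisms.algebraMapΓ (pullback.snd f (Spec.map (CommRingCat.ofHom q))))).IsRoot θ)
    (hθ' : IsUnit ((F.map (Morphisms.algebraMapΓ
      (pullback.snd f (Spec.map (CommRingCat.ofHom q))))).derivative.eval θ)) :
    θ ∈ (Morphisms.algebraMapΓ (pullback.snd f (Spec.map (CommRingCat.ofHom q)))).range := by
  set I : Ideal A := RingHom.ker q with hIdef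
  have hI : I ≤ RingHom.ker q := le_rfl
  set g := pullback.snd f (Spec.map (CommRingCat.ofHom q)) with hg
  set p := pullback.fst f (Spec.map (CommRingCat.ofHom q)) with hp
  set σ : (n : ℕ) →
      (pullback f (Spec.map (CommRingCat.ofHom q)) ⟶ Morphisms.infinitesimalNeighbourhood I f n) :=
    fun n ↦ Morphisms.toInfinitesimalNeighbourhood I f q hI n with hσ
  haveI : Fact (Function.Surjective q) := ⟨hq⟩
  haveI hσs : ∀ n, Surjective (σ n) := fun n ↦
    Morphisms.surjective_toInfinitesimalNeighbourhood I f q hI hq le_rfl n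
  -- lift `F` to a monic `G ∈ A[T]`
  obtain ⟨G, hGF, -, hG⟩ := Polynomial.lifts_and_natDegree_eq_and_monic
    ((Polynomial.mem_lifts _).mpr (Polynomial.map_surjective q hq F)) hF
  -- the polynomial `G` on `X_n`, and its pull-back to `X₀`
  set φ : (n : ℕ) → (A →+* Γ(Morphisms.infinitesimalNeighbourhood I f n, ⊤)) :=
    fun n ↦ (restrict I f n).comp (Morphisms.algebraMapΓ f) with hφ
  have hφσ : ∀ n, (σ n).appTop.hom.comp (φ n) = (Morphisms.algebraMapΓ g).comp q := by
    intro n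
    ext a
    change (σ n).appTop.hom ((ι I f n).appTop.hom (Morphisms.algebraMapΓ f a)) = Morphisms.algebraMapΓ g (q a)
    rw [← Morphisms.appTop_fst_algebraMapΓ, ← Morphisms.toInfinitesimalNeighbourhood_ι I f q hI n,
      Scheme.Hom.comp_appTop]
    rfl
  have hGσ : ∀ n, ((G.map (φ n)).map (σ n).appTop.hom) = F.map (Morphisms.algebraMapΓ g) := by
    intro n
    rw [Polynomial.map_map, hφσ, ← Polynomial.map_map, hGF]
  -- instances on `X_n`
  haveI : ∀ n, IsNoetherianRing (CommRingCat.of (A ⧸ I ^ (n + 1))) := fun n ↦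
    inferInstanceAs (IsNoetherianRing (A ⧸ I ^ (n + 1)))
  haveI : ∀ n, CompactSpace ↥(Morphisms.infinitesimalNeighbourhood I f n) := fun n ↦ inferInstance
  haveI : ∀ n, IsLocallyNoetherian (Morphisms.infinitesimalNeighbourhood I f n) := fun n ↦ inferInstance
  -- unique lifts `y n` of `θ` to roots of `G` on `X_n`
  have hex : ∀ n, ∃! y : Γ(Morphisms.infinitesimalNeighbourhood I f n, ⊤),
      (G.map (φ n)).IsRoot y ∧ (σ n).appTop y = θ := fun n ↦
    existsUnique_isRoot_of_isClosedImmersion (σ := σ n) (hG.map _) (by rwa [hGσ])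
      (by rwa [hGσ])
  choose y hy hyu using hex
  -- compatibility under the transition maps
  have hcompat : ∀ n, (transition I f n).appTop.hom (y (n + 1)) = y n := by
    intro n
    refine hyu n _ ⟨?_, ?_⟩
    · have e : (G.map (φ (n + 1))).map (transition I f n).appTop.hom = G.map (φ n) := by
        rw [Polynomial.map_map]
        congr 1
        ext a
        exact transition_appTop_restrict I f n (Morphisms.algebraMapΓ f a)
      rw [IsRoot.def, ← e, eval_map, eval₂_hom, (hy (n + 1)).1.eq_zero, map_zero]
    · change ((transition I f n).appTop ≫ (σ n).appTop) (y (n + 1)) = θ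
      rw [← Scheme.Hom.comp_appTop, hσ, Morphisms.toInfinitesimalNeighbourhood_transition]
      exact (hy (n + 1)).2
  -- formal functions: `(y n)` comes from a Cauchy sequence of global functions
  obtain ⟨m, -, hm⟩ := hFF y hcompat
  obtain ⟨a, ha⟩ := hΓ.2 (m 0)
  refine ⟨q a, ?_⟩
  rw [← Morphisms.appTop_fst_algebraMapΓ, ha, ← (hy 0).2, ← hm 0]
  change _ = ((ι I f 0).appTop ≫ (σ 0).appTop) (m 0)
  rw [← Scheme.Hom.comp_appTop, hσ, Morphisms.toInfinitesimalNeighbourhood_ι]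

end SimpleRoots

end Literature.AlgebraicGeometry.Motives

namespace Literature.AlgebraicGeometry.Motives

/-! ### Idempotent functions and connectedness -/

/-- A scheme all of whose idempotent global functions are `0` or `1` is preconnected: a clopen
subset `U` carries the indicator function (glue `1` on `U` and `0` on the complement), a
non-trivial idempotent unless `U` or its complement is empty (non-empty opens of a scheme have
non-zero rings of functions). [folklore] -/
theorem preconnectedSpace_of_isIdempotentElem (Y : Scheme.{u})
    (h : ∀ e : Γ(Y, ⊤), IsIdempotentElem e → e = 0 ∨ e = 1) : PreconnectedSpace Y := by
  rw [preconnectedSpace_iff_clopen]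
  intro s hs
  let U : Y.Opens := ⟨s, hs.isOpen⟩
  let V : Y.Opens := ⟨sᶜ, hs.compl.isOpen⟩
  have hUV : U ⊔ V = ⊤ := by
    ext x
    simp only [Opens.coe_sup, Set.mem_union, Opens.coe_top, Set.mem_univ, iff_true, U, V]
    exact em _
  have hUV' : U ⊓ V = ⊥ := by
    ext x
    simp [U, V]
  have hsub : Subsingleton (Y.sheaf.1.obj (op (U ⊓ V))) :=
    CommRingCat.subsingleton_of_isTerminal (Y.sheaf.isTerminalOfEqEmpty hUV')
  -- glue `1` on `U` and `0` on `V`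
  let x : RingHom.eqLocus
      ((Y.sheaf.1.map (homOfLE inf_le_left : U ⊓ V ⟶ U).op).hom.comp
        (RingHom.fst Γ(Y, U) Γ(Y, V)))
      ((Y.sheaf.1.map (homOfLE inf_le_right : U ⊓ V ⟶ V).op).hom.comp
        (RingHom.snd Γ(Y, U) Γ(Y, V))) :=
    ⟨((1 : Γ(Y, U)), (0 : Γ(Y, V))), hsub.elim _ _⟩
  let e' : Γ(Y, U ⊔ V) := (Y.sheaf.objSupIsoProdEqLocus U V).inv x
  let e : Γ(Y, ⊤) := Y.presheaf.map (eqToHom hUV.symm).op e'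
  have heU : Y.presheaf.map (homOfLE (le_top : U ≤ ⊤)).op e = 1 := by
    change (Y.presheaf.map (eqToHom hUV.symm).op ≫ Y.presheaf.map (homOfLE le_top).op) e' = 1
    rw [← Functor.map_comp, ← op_comp,
      show homOfLE (le_top : U ≤ ⊤) ≫ eqToHom hUV.symm = homOfLE le_sup_left from
        Subsingleton.elim _ _]
    exact Y.sheaf.objSupIsoProdEqLocus_inv_fst U V x
  have heV : Y.presheaf.map (homOfLE (le_top : V ≤ ⊤)).op e = 0 := by
    change (Y.presheaf.map (eqToHom hUV.symm).op ≫ Y.presheaf.map (homOfLE le_top).op) e' = 0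
    rw [← Functor.map_comp, ← op_comp,
      show homOfLE (le_top : V ≤ ⊤) ≫ eqToHom hUV.symm = homOfLE le_sup_right from
        Subsingleton.elim _ _]
    exact Y.sheaf.objSupIsoProdEqLocus_inv_snd U V x
  have he : IsIdempotentElem e := by
    change e * e = e
    apply Y.sheaf.eq_of_locally_eq₂ (homOfLE (le_top : U ≤ ⊤)) (homOfLE (le_top : V ≤ ⊤))
      (by rw [hUV])
    · change Y.presheaf.map _ (e * e) = Y.presheaf.map _ e
      rw [map_mul, heU, mul_one]
    · change Y.presheaf.map _ (e * e) = Y.presheaf.map _ e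
      rw [map_mul, heV, mul_zero]
  rcases h e he with h0 | h1
  · -- `e = 0`: then `1 = 0` on `U`, so `U = ∅`
    left
    by_contra hne
    haveI : Nonempty U := by
      obtain ⟨y, hy⟩ := Set.nonempty_iff_ne_empty.mpr hne
      exact ⟨⟨y, hy⟩⟩
    have : (1 : Γ(Y, U)) = 0 := by rw [← heU, h0, map_zero]
    exact one_ne_zero this
  · -- `e = 1`: then `0 = 1` on `V`, so `V = ∅`
    right
    by_contra hne
    haveI : Nonempty V := by
      obtain ⟨y, hy⟩ := Set.nonempty_compl.mpr hne
      exact ⟨⟨y, hy⟩⟩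
    have : (0 : Γ(Y, V)) = 1 := by rw [← heV, h1, map_one]
    exact zero_ne_one this

/-- In particular a scheme whose ring of global functions is a field (or a domain) is
preconnected. [folklore] -/
theorem preconnectedSpace_of_isField (Y : Scheme.{u}) (h : IsField Γ(Y, ⊤)) :
    PreconnectedSpace Y := by
  letI := h.toField
  exact preconnectedSpace_of_isIdempotentElem Y fun e he ↦ IsIdempotentElem.iff_eq_zero_or_one.mp he

/-! ### Flat base change of `H⁰` and geometric connectedness -/

/-- **`H⁰(X, 𝒪_X) = k` implies `X` geometrically connected.** Let `g : Y → Spec k` be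
quasi-compact and quasi-separated with `Y` non-empty and `k = Γ(Spec k, 𝒪) → Γ(Y, 𝒪_Y)` an
isomorphism. Then `g` is geometrically connected: for a field extension `K/k`, flat base change
(Mathlib `isIso_pushoutSection_of_isQuasiSeparated_of_flat_right`; Stacks Project, Tag 02KH)
gives `Γ(Y_K, 𝒪) = Γ(Y, 𝒪_Y) ⊗_k K = K`, a field, so `Y_K` has no non-trivial idempotent
functions and is connected (Stacks Project, Tag 0FD1-type statement; cf. Varieties,
Lemma 33.7.x). [cite: StacksProject, Tag 02KH (Cohomology of Schemes, Lemma 30.5.2: flat base change)] -/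
theorem geometricallyConnected_of_isIso_appTop {k : Type u} [Field k] {Y : Scheme.{u}}
    (g : Y ⟶ Spec (.of k)) [CompactSpace Y] [QuasiSeparatedSpace Y] [Nonempty Y]
    [IsIso g.appTop] : GeometricallyConnected g := by
  refine ⟨fun K _ y Z fst snd h ↦ ?_⟩
  -- `y : Spec K → Spec k` is flat
  obtain ⟨φ, rfl⟩ := Spec.map_surjective y
  haveI : Flat (Spec.map φ) := by
    rw [HasRingHomProperty.Spec_iff (P := @Flat)]
    algebraize [φ.hom]
    exact inferInstanceAs (Module.Flat k K)
  -- flat base change: `Γ(Z, 𝒪) = Γ(Y, 𝒪) ⊗_k K`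
  have hiso := isIso_pushoutSection_of_isQuasiSeparated_of_flat_right h
    (US := ⊤) (UT := ⊤) (UX := ⊤) (UY := ⊤) le_top le_top (by simp) (isAffineOpen_top _)
    (isAffineOpen_top _) isCompact_univ isQuasiSeparated_univ
  have hinr : pushout.inr _ _ ≫ pushoutSection h (US := ⊤) (UT := ⊤) (UX := ⊤) (UY := ⊤)
      le_top le_top (by simp) = snd.appLE ⊤ ⊤ (by simp) :=
    pushout.inr_desc _ _ _
  haveI : IsIso (g.appLE (⊤ : (Spec (.of k)).Opens) ⊤ le_top) := by
    rw [show g.appLE ⊤ ⊤ le_top = g.appTop from (Scheme.Hom.app_eq_appLE g).symm]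
    infer_instance
  haveI : IsIso (snd.appLE (⊤ : (Spec (.of K)).Opens) ⊤ (by simp)) := by
    rw [← hinr]; infer_instance
  haveI : IsIso snd.appTop := by
    rw [show snd.appTop = snd.appLE ⊤ ⊤ (by simp) from Scheme.Hom.app_eq_appLE snd]
    infer_instance
  -- so `Γ(Z, 𝒪)` is a field
  have hF : IsField Γ(Z, ⊤) :=
    ((asIso snd.appTop).symm ≪≫ Scheme.ΓSpecIso (.of K)).commRingCatIsoToRingEquiv.toMulEquiv
      |>.isField (Field.toIsField K)
  haveI : PreconnectedSpace Z := preconnectedSpace_of_isField Z hF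
  -- and `Z` is non-empty (`Z → Y` is surjective, a base change of `Spec K → Spec k`)
  haveI : Surjective fst := MorphismProperty.of_isPullback (P := @Surjective) h.flip inferInstance
  haveI : Nonempty Z := by
    obtain ⟨z, -⟩ := fst.surjective (Classical.arbitrary Y)
    exact ⟨z⟩
  exact ⟨inferInstance⟩

end Literature.AlgebraicGeometry.Motives

namespace Literature.AlgebraicGeometry.Motives

/-! ### `Γ(X, 𝒪_X) = R` for flat proper `X → Spec R` with `H⁰(X_K, 𝒪) = K` -/

section GenericFibre

variable {R K : Type u} [CommRing R] [Field K] [Algebra R K] [IsFractionRing R K]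

/-- **`f_* 𝒪_X = 𝒪_S` for a flat universally closed `X → Spec R`, checked on the generic
fibre.** Let `R` be an integrally closed domain with fraction field `K` and `f : X → Spec R`
flat and universally closed (hence quasi-compact), with non-empty generic fibre `X_K`
such that `K` is integrally closed in `Γ(X_K, 𝒪)`. Then `Γ(Spec R, 𝒪) → Γ(X, 𝒪_X)` is
bijective: injective as `Γ(X, 𝒪) → Γ(X_K, 𝒪)` is (the generic fibre is schematically dense,
`f` flat), and surjective because every global function `b` is integral over `R` (Mathlib
`isIntegral_appTop_of_universallyClosed`), so `b |_{X_K} = c ∈ K` is integral over `R`, i.e.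
`c ∈ R` (cf. `isIso_fromNormalization_of_genericFibre`, the same argument for integral elements;
Stacks Project, Tag 0AY8, proof). [cite: StacksProject, Tag 0AY8 (More on Morphisms, Lemma 37.53.6, proof)] -/
theorem bijective_appTop_of_genericFibre [IsIntegrallyClosed R]
    {X : Scheme.{u}} (f : X ⟶ Spec (.of R)) [Flat f] [UniversallyClosed f]
    [Nonempty ↥(pullback f (Spec.map (CommRingCat.ofHom (algebraMap R K))))]
    (hK : ∀ b : Γ(pullback f (Spec.map (CommRingCat.ofHom (algebraMap R K))), ⊤),
      ((Scheme.ΓSpecIso (.of K)).inv ≫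
          (pullback.snd f
            (Spec.map (CommRingCat.ofHom (algebraMap R K)))).appTop).hom.IsIntegralElem b →
        b ∈ ((Scheme.ΓSpecIso (.of K)).inv ≫
          (pullback.snd f (Spec.map (CommRingCat.ofHom (algebraMap R K)))).appTop).hom.range) :
    Function.Bijective f.appTop := by
  set i : Spec (.of K) ⟶ Spec (.of R) := Spec.map (CommRingCat.ofHom (algebraMap R K)) with hi
  set p := pullback.fst f i
  set gK := pullback.snd f i
  set eR := Scheme.ΓSpecIso (.of R)
  set eK := Scheme.ΓSpecIso (.of K)
  set φ₀ : Γ(Spec (.of R), ⊤) →+* Γ(X, ⊤) := f.appTop.hom with hφ₀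
  set ρ : Γ(X, ⊤) →+* Γ(pullback f i, ⊤) := p.appTop.hom with hρdef
  set ι₀ : Γ(Spec (.of R), ⊤) →+* Γ(Spec (.of K), ⊤) := i.appTop.hom with hι₀
  set γ₀ : Γ(Spec (.of K), ⊤) →+* Γ(pullback f i, ⊤) := gK.appTop.hom with hγ₀
  -- the square of global sections
  have hsq : ρ.comp φ₀ = γ₀.comp ι₀ := by
    change (f.appTop ≫ p.appTop).hom = (i.appTop ≫ gK.appTop).hom
    rw [← Scheme.Hom.comp_appTop, ← Scheme.Hom.comp_appTop, pullback.condition]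
  have hsq' : ∀ a, ρ (φ₀ a) = γ₀ (ι₀ a) := fun a ↦ congr($hsq a)
  -- naturality of `ΓSpecIso`
  have hnat : eK.hom.hom.comp ι₀ = (algebraMap R K).comp eR.hom.hom := by
    change (i.appTop ≫ eK.hom).hom = (eR.hom ≫ CommRingCat.ofHom (algebraMap R K)).hom
    rw [hi, Scheme.ΓSpecIso_naturality]
  have hnat' : ∀ r : R, ι₀ (eR.inv r) = eK.inv (algebraMap R K r) := fun r ↦ by
    change (eR.inv ≫ i.appTop).hom r = (CommRingCat.ofHom (algebraMap R K) ≫ eK.inv).hom r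
    rw [hi, Scheme.ΓSpecIso_inv_naturality]
  -- `ρ` is injective: the generic fibre is schematically dense (`f` flat)
  haveI : IsSchemeTheoreticallyDominant i :=
    isSchemeTheoreticallyDominant_SpecMap _ (IsFractionRing.injective R K)
  have hρ : Function.Injective ρ := p.app_injective ⊤
  -- `γ₀` is injective: `K` is a field and the generic fibre is non-empty
  have hγ : Function.Injective γ₀ := by
    haveI : Nonempty ↥(⊤ : (pullback f i).Opens) := ⟨⟨Classical.arbitrary _, trivial⟩⟩
    have h := (γ₀.comp eK.inv.hom).injective
    exact (Function.Injective.of_comp_iff' _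
      eK.symm.commRingCatIsoToRingEquiv.bijective).mp h
  -- `ι₀` is injective
  have hι : Function.Injective ι₀ := injective_appTop_SpecMap _ (IsFractionRing.injective R K)
  refine ⟨?_, fun b ↦ ?_⟩
  · have : Function.Injective (ρ.comp φ₀) := hsq ▸ hγ.comp hι
    exact Function.Injective.of_comp this
  · -- `b` is integral over `R`
    have hb : φ₀.IsIntegralElem b := isIntegral_appTop_of_universallyClosed f b
    have h1 : (γ₀.comp ι₀).IsIntegralElem (ρ b) := hsq ▸ hb.map ρ
    have h2 : γ₀.IsIntegralElem (ρ b) := h1.of_comp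
    -- `K` is integrally closed in `Γ(X_K, 𝒪)`: `ρ b` comes from `c' ∈ Γ(Spec K, 𝒪)`
    have h2' : (eK.inv ≫ gK.appTop).hom.IsIntegralElem (ρ b) := by
      have : (eK.inv ≫ gK.appTop).hom.comp eK.hom.hom = γ₀ := by
        ext x; simp [hγ₀]
      exact RingHom.IsIntegralElem.of_comp (f := eK.hom.hom) (this ▸ h2)
    obtain ⟨c, hc⟩ := hK (ρ b) h2'
    set c' := eK.inv c with hc'
    have hc'' : γ₀ c' = ρ b := hc
    -- `c'` is integral over `R`, hence comes from `R`
    have h3 : ι₀.IsIntegralElem c' := RingHom.IsIntegralElem.of_map hγ (hc'' ▸ h1)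
    have h4 : IsIntegral R (eK.hom c') := by
      have := h3.map eK.hom.hom
      rw [hnat] at this
      exact this.of_comp
    obtain ⟨r, hr⟩ := IsIntegrallyClosed.algebraMap_eq_of_integral h4
    -- hence `b = φ₀ (eR⁻¹ r)`
    refine ⟨eR.inv r, hρ ?_⟩
    change ρ (φ₀ (eR.inv r)) = ρ b
    rw [hsq', hnat', hr, ← hc'']
    congr 1
    simp [hc']

end GenericFibre

/-! ### Separable elements of a reduced algebra over a perfect field are simple roots -/

/-- In a reduced algebra `Λ` over a perfect field `k`, every element `x` integral over `k` is a
simple root of its (monic) minimal polynomial `μ`: `μ` is radical (if `μ ∣ p^n` then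
`p(x)^n = 0`, so `p(x) = 0` as `Λ` is reduced, so `μ ∣ p`), hence square-free, hence separable
(`k` perfect), i.e. `a μ + b μ' = 1`, whence `μ'(x)` is a unit. [folklore] -/
theorem isUnit_aeval_derivative_minpoly {k Λ : Type*} [Field k] [PerfectField k] [CommRing Λ]
    [IsReduced Λ] [Algebra k Λ] {x : Λ} (hx : IsIntegral k x) :
    IsUnit (Polynomial.aeval x (Polynomial.derivative (minpoly k x))) := by
  have hrad : IsRadical (minpoly k x) := by
    intro n p hp
    apply minpoly.dvd
    have h0 : (Polynomial.aeval x p) ^ n = 0 := by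
      obtain ⟨c, hc⟩ := hp
      rw [← map_pow, hc, map_mul, minpoly.aeval, zero_mul]
    exact IsNilpotent.eq_zero ⟨n, h0⟩
  have hsf : Squarefree (minpoly k x) :=
    (isRadical_iff_squarefree_of_ne_zero (minpoly.ne_zero hx)).mp hrad
  have hsep : (minpoly k x).Separable := PerfectField.separable_iff_squarefree.mpr hsf
  obtain ⟨a, b, hab⟩ := hsep
  have := congr(Polynomial.aeval x $hab)
  rw [map_add, map_mul, map_mul, minpoly.aeval, mul_zero, zero_add, map_one, mul_comm] at this
  exact IsUnit.of_mul_eq_one _ this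

/-! ### Zariski's connectedness theorem from the theorem on formal functions -/

section ClosedFibre

variable {A : Type u} [CommRing A] [IsNoetherianRing A] {X : Scheme.{u}} (f : X ⟶ Spec (.of A))
  [IsProper f] {k₀ : Type u} [Field k₀] (q : A →+* k₀)

/-- **Zariski's connectedness theorem (connected closed fibre)**, granting the surjectivity half
of the theorem on formal functions for `(A, ker q, f)`: if `A` is Noetherian, `q : A → k₀` is a
surjection onto a field, `f : X → Spec A` is proper with `A → Γ(X, 𝒪_X)` bijective and
`HasSurjectiveFormalFunctions (ker q) f` holds, then the closed fibre `X ×_A k₀` is preconnected: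
an idempotent function `e` on it is a simple root of `T² - T` (`(2e - 1)² = 1`), hence constant
(`mem_range_algebraMapΓ_of_isRoot`), hence `0` or `1`; conclude by
`preconnectedSpace_of_isIdempotentElem`. This is the last step of the printed proof of Stacks
Project, Tag 03H0 (More on Morphisms, Theorem 37.53.4), with Hensel's lemma for `T² - T` in place
of the topological lifting of idempotents. [cite: StacksProject, Tag 03H0 (More on Morphisms, Theorem 37.53.4, proof) and Tag 02OC] -/
theorem preconnectedSpace_pullback_of_hasSurjectiveFormalFunctions
    (hFF : Morphisms.HasSurjectiveFormalFunctions (RingHom.ker q) f) (hq : Function.Surjective q)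
    (hΓ : Function.Bijective (Morphisms.algebraMapΓ f)) :
    PreconnectedSpace ↥(pullback f (Spec.map (CommRingCat.ofHom q))) := by
  set g := pullback.snd f (Spec.map (CommRingCat.ofHom q)) with hg
  refine preconnectedSpace_of_isIdempotentElem _ fun e he ↦ ?_
  -- `e` is a simple root of `T² - T`
  have hF : (Polynomial.X ^ 2 - Polynomial.X : k₀[X]).Monic :=
    (Polynomial.monic_X_pow 2).sub_of_left (by
      rw [Polynomial.degree_X_pow, Polynomial.degree_X]; exact Nat.one_lt_ofNat)
  have hroot : ((Polynomial.X ^ 2 - Polynomial.X : k₀[X]).map (Morphisms.algebraMapΓ g)).IsRoot e := by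
    rw [IsRoot.def, Polynomial.map_sub, Polynomial.map_pow, Polynomial.map_X, eval_sub, eval_pow,
      eval_X, sq, he.eq, sub_self]
  have hunit : IsUnit (((Polynomial.X ^ 2 - Polynomial.X : k₀[X]).map
      (Morphisms.algebraMapΓ g)).derivative.eval e) := by
    have hd : ((Polynomial.X ^ 2 - Polynomial.X : k₀[X]).map (Morphisms.algebraMapΓ g)).derivative.eval e =
        2 * e - 1 := by
      rw [Polynomial.map_sub, Polynomial.map_pow, Polynomial.map_X, Polynomial.derivative_sub,
        Polynomial.derivative_X_pow, Polynomial.derivative_X, eval_sub, eval_mul, eval_C,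
        eval_one, eval_pow, eval_X, Nat.cast_ofNat, Nat.add_one_sub_one, pow_one]
    rw [hd]
    exact IsUnit.of_mul_eq_one (2 * e - 1)
      (by linear_combination (4 : Γ(pullback f (Spec.map (CommRingCat.ofHom q)), ⊤)) * he.eq)
  -- hence constant, `e = q a`, and `q a` is an idempotent of the field `k₀`
  obtain ⟨c, hc⟩ := mem_range_algebraMapΓ_of_isRoot f q hFF hq hΓ _ hF e hroot hunit
  rcases isEmpty_or_nonempty ↥(pullback f (Spec.map (CommRingCat.ofHom q))) with hemp | hne
  · left
    haveI : Subsingleton Γ(pullback f (Spec.map (CommRingCat.ofHom q)), ⊤) :=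
      CommRingCat.subsingleton_of_isTerminal
        ((pullback f (Spec.map (CommRingCat.ofHom q))).sheaf.isTerminalOfEqEmpty (by
          ext x; exact (IsEmpty.false x).elim))
    exact Subsingleton.elim _ _
  · haveI : Nonempty ↥(⊤ : (pullback f (Spec.map (CommRingCat.ofHom q))).Opens) :=
      ⟨⟨Classical.arbitrary _, trivial⟩⟩
    have hinj : Function.Injective (Morphisms.algebraMapΓ g) := (Morphisms.algebraMapΓ g).injective
    have hcc : c * c = c := hinj (by rw [map_mul, hc, he.eq])
    rcases IsIdempotentElem.iff_eq_zero_or_one.mp (hcc : IsIdempotentElem c) with h0 | h1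
    · left; rw [← hc, h0, map_zero]
    · right; rw [← hc, h1, map_one]

variable [PerfectField k₀]

/-- **`H⁰(X₀, 𝒪) = k₀` for a reduced closed fibre over a perfect residue field**, granting the
surjectivity half of the theorem on formal functions for `(A, ker q, f)` (Stacks Project,
Tag 02OC): with `A` Noetherian, `q : A → k₀` a surjection onto a perfect field, `f : X → Spec A`
proper with `A → Γ(X, 𝒪_X)` bijective and `X₀ = X ×_A k₀` reduced, every function on `X₀` is
constant — it is integral over `k₀` (Mathlib `isIntegral_appTop_of_universallyClosed`) and a
simple root of its minimal polynomial (`isUnit_aeval_derivative_minpoly`), so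
`mem_range_algebraMapΓ_of_isRoot` applies. [cite: StacksProject, Tag 02OC (Cohomology of Schemes, Theorem 30.20.5) and Tag 03H0 (More on Morphisms, proof of Theorem 37.53.4)] -/
theorem surjective_algebraMapΓ_snd_of_isReduced
    (hFF : Morphisms.HasSurjectiveFormalFunctions (RingHom.ker q) f) (hq : Function.Surjective q)
    (hΓ : Function.Bijective (Morphisms.algebraMapΓ f))
    [IsReduced (pullback f (Spec.map (CommRingCat.ofHom q)))] :
    Function.Surjective (Morphisms.algebraMapΓ (pullback.snd f (Spec.map (CommRingCat.ofHom q)))) := by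
  set g := pullback.snd f (Spec.map (CommRingCat.ofHom q)) with hg
  set Λ := Γ(pullback f (Spec.map (CommRingCat.ofHom q)), ⊤) with hΛ
  letI : Algebra k₀ Λ := (Morphisms.algebraMapΓ g).toAlgebra
  set ek := Scheme.ΓSpecIso (.of k₀) with hek
  -- every function on the fibre is integral over `k₀`
  have hint : ∀ x : Λ, IsIntegral k₀ x := by
    intro x
    obtain ⟨p, hp, hpx⟩ := isIntegral_appTop_of_universallyClosed g x
    refine ⟨p.map ek.hom.hom, hp.map _, ?_⟩
    rw [Polynomial.eval₂_map]
    convert hpx using 2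
    ext a
    change g.appTop.hom (ek.inv (ek.hom a)) = g.appTop.hom a
    rw [Iso.hom_inv_id_apply]
  -- and is a simple root of its minimal polynomial, hence constant
  intro x
  have hu := isUnit_aeval_derivative_minpoly (hint x)
  exact mem_range_algebraMapΓ_of_isRoot f q hFF hq hΓ (minpoly k₀ x) (minpoly.monic (hint x)) x
    (by rw [IsRoot.def, eval_map]; exact minpoly.aeval k₀ x)
    (by rw [Polynomial.derivative_map, eval_map]; exact hu)

/-- Under the same hypotheses and `X₀ ≠ ∅`, `k₀ = Γ(Spec k₀, 𝒪) → Γ(X₀, 𝒪)` is an isomorphism.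
[cite: StacksProject, Tag 02OC (Cohomology of Schemes, Theorem 30.20.5) and Tag 03H0 (More on Morphisms, proof of Theorem 37.53.4)] -/
theorem isIso_appTop_snd_of_isReduced
    (hFF : Morphisms.HasSurjectiveFormalFunctions (RingHom.ker q) f) (hq : Function.Surjective q)
    (hΓ : Function.Bijective (Morphisms.algebraMapΓ f))
    [IsReduced (pullback f (Spec.map (CommRingCat.ofHom q)))]
    [Nonempty ↥(pullback f (Spec.map (CommRingCat.ofHom q)))] :
    IsIso (pullback.snd f (Spec.map (CommRingCat.ofHom q))).appTop := by
  set g := pullback.snd f (Spec.map (CommRingCat.ofHom q)) with hg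
  set ek := Scheme.ΓSpecIso (.of k₀) with hek
  haveI : Nonempty ↥(⊤ : (pullback f (Spec.map (CommRingCat.ofHom q))).Opens) :=
    ⟨⟨Classical.arbitrary _, trivial⟩⟩
  have hinj : Function.Injective (Morphisms.algebraMapΓ g) := (Morphisms.algebraMapΓ g).injective
  have hsurj := surjective_algebraMapΓ_snd_of_isReduced f q hFF hq hΓ
  have hbij : Function.Bijective g.appTop := by
    have : g.appTop.hom = (Morphisms.algebraMapΓ g).comp ek.hom.hom := by
      ext a
      change g.appTop.hom a = g.appTop.hom (ek.inv (ek.hom a))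
      rw [Iso.hom_inv_id_apply]
    change Function.Bijective g.appTop.hom
    rw [this]
    exact (Function.Bijective.of_comp_iff' ⟨hinj, hsurj⟩ _).mpr
      ek.commRingCatIsoToRingEquiv.bijective
  exact (ConcreteCategory.isIso_iff_bijective _).mpr hbij

/-- **Zariski's connectedness theorem (geometrically connected closed fibre) for a reduced fibre
over a perfect residue field**, granting the surjectivity half of the theorem on formal functions
for `(A, ker q, f)`: the closed fibre `X₀ = X ×_A k₀ → Spec k₀` is geometrically connected
(`H⁰(X₀, 𝒪) = k₀` by `isIso_appTop_snd_of_isReduced`, then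
`geometricallyConnected_of_isIso_appTop`). [cite: StacksProject, Tag 03H0 (More on Morphisms, Theorem 37.53.4) and Tag 02OC] -/
theorem geometricallyConnected_snd_of_isReduced
    (hFF : Morphisms.HasSurjectiveFormalFunctions (RingHom.ker q) f) (hq : Function.Surjective q)
    (hΓ : Function.Bijective (Morphisms.algebraMapΓ f))
    [IsReduced (pullback f (Spec.map (CommRingCat.ofHom q)))]
    [Nonempty ↥(pullback f (Spec.map (CommRingCat.ofHom q)))] :
    GeometricallyConnected (pullback.snd f (Spec.map (CommRingCat.ofHom q))) := by
  haveI := isIso_appTop_snd_of_isReduced f q hFF hq hΓ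
  haveI : QuasiSeparatedSpace ↥(pullback f (Spec.map (CommRingCat.ofHom q))) :=
    quasiSeparatedSpace_of_quasiSeparated (pullback.snd f (Spec.map (CommRingCat.ofHom q)))
  exact geometricallyConnected_of_isIso_appTop _

end ClosedFibre

end Literature.AlgebraicGeometry.Motives

/-! ### The special fibre of a smooth proper model -/

namespace Literature.AlgebraicGeometry.Motives.IntegralModel

open scoped NumberField

open IsDedekindDomain IsDedekindDomain.HeightOneSpectrum Morphisms Polynomial

variable {K : Type} [Field K] [NumberField K] {v : HeightOneSpectrum (𝓞 K)} {X : SchemeOver K}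
  (𝒳 : IntegralModel (valuationSubringAtPrime K v) K X)

/-- **`Γ(𝒳, 𝒪) = 𝓞_{K,v}` for a smooth proper model.** If `X/K` is smooth projective and
geometrically irreducible and `𝒳 → Spec 𝓞_{K,v}` is a smooth proper model, then
`𝓞_{K,v} → Γ(𝒳, 𝒪_𝒳)` is bijective (`bijective_appTop_of_genericFibre`: the generic fibre
`𝒳_K ≅ X` is integral and geometrically irreducible, so `K` is integrally closed in `Γ(X, 𝒪_X)`,
and global functions on the proper `𝒳` are integral over `𝓞_{K,v}`; Stacks Project, Tag 0AY8,
proof). [cite: StacksProject, Tag 0AY8 (More on Morphisms, Lemma 37.53.6, proof)] -/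
theorem bijective_algebraMapΓ {n : ℕ} (hX : IsSmoothProjective n X) (h : 𝒳.IsSmoothProper n) :
    Function.Bijective (algebraMapΓ 𝒳.total.hom) := by
  haveI := h.1
  haveI := h.2
  haveI : Smooth 𝒳.total.hom := SmoothOfRelativeDimension.smooth n _
  haveI := smoothOfRelativeDimension_isStableUnderBaseChange (n := n)
  set i : Spec (.of K) ⟶ Spec (.of (valuationSubringAtPrime K v)) :=
    Spec.map (CommRingCat.ofHom (algebraMap (valuationSubringAtPrime K v) K)) with hi
  -- the generic fibre `𝒳_K ≅ X` is smooth and geometrically irreducible over `K`, hence integral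
  have hgK : pullback.snd 𝒳.total.hom i = 𝒳.genericIso.hom.left ≫ X.hom :=
    (Over.w 𝒳.genericIso.hom).symm
  haveI : @IsIso _ _ (pullback 𝒳.total.hom i) X.left 𝒳.genericIso.hom.left :=
    inferInstanceAs (IsIso ((Over.forget _).mapIso 𝒳.genericIso).hom)
  haveI : GeometricallyIrreducible (pullback.snd 𝒳.total.hom i) := by
    rw [hgK]
    exact MorphismProperty.RespectsIso.precomp (P := @GeometricallyIrreducible) _ _
      hX.geometricallyIrreducible
  haveI : IrreducibleSpace ↥(pullback 𝒳.total.hom i) :=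
    GeometricallyIrreducible.irreducibleSpace_of_subsingleton (f := pullback.snd 𝒳.total.hom i)
  haveI : SmoothOfRelativeDimension n (pullback.snd 𝒳.total.hom i) :=
    MorphismProperty.pullback_snd _ _ ‹_›
  haveI : IsReduced (pullback 𝒳.total.hom i) :=
    isReduced_of_smoothOfRelativeDimension (pullback.snd 𝒳.total.hom i) n
  haveI : IsIntegral (pullback 𝒳.total.hom i) := isIntegral_of_irreducibleSpace_of_isReduced _
  have hbij : Function.Bijective 𝒳.total.hom.appTop :=
    bijective_appTop_of_genericFibre (K := K) 𝒳.total.hom fun b hb ↦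
      mem_range_of_isIntegralElem_of_geometricallyIrreducible _ b hb
  exact hbij.comp
    (Scheme.ΓSpecIso (.of (valuationSubringAtPrime K v))).symm.commRingCatIsoToRingEquiv.bijective

/-- A smooth proper model `𝒳 → Spec 𝓞_{K,v}` (of a non-empty `X`) is surjective: its image is
open (`𝒳 → Spec 𝓞_{K,v}` is flat and locally of finite presentation, hence universally open),
closed (properness) and non-empty in the irreducible `Spec 𝓞_{K,v}`. [folklore] -/
theorem surjective_total_hom {n : ℕ} (hX : IsSmoothProjective n X) (h : 𝒳.IsSmoothProper n) :
    Surjective 𝒳.total.hom := by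
  haveI := h.1
  haveI := h.2
  haveI : Smooth 𝒳.total.hom := SmoothOfRelativeDimension.smooth n _
  -- `𝒳` is non-empty: its generic fibre is `X ≠ ∅`
  haveI : Nonempty ↥𝒳.total.left := by
    haveI := hX.geometricallyIrreducible
    haveI : Surjective X.hom := inferInstance
    haveI : Nonempty ↥X.left := by
      obtain ⟨x, -⟩ := X.hom.surjective (Classical.arbitrary _)
      exact ⟨x⟩
    haveI : IsIso 𝒳.genericIso.hom.left :=
      inferInstanceAs (IsIso ((Over.forget _).mapIso 𝒳.genericIso).hom)
    obtain ⟨y, -⟩ := (𝒳.genericIso.hom.left).surjective (Classical.arbitrary X.left)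
    exact ⟨(pullback.fst 𝒳.total.hom _).base y⟩
  have hopen : IsOpen (Set.range 𝒳.total.hom.base) := 𝒳.total.hom.isOpenMap.isOpen_range
  have hclosed : IsClosed (Set.range 𝒳.total.hom.base) :=
    𝒳.total.hom.isClosedMap.isClosed_range
  exact ⟨Set.range_eq_univ.mp (IsClopen.eq_univ ⟨hclosed, hopen⟩ (Set.range_nonempty _))⟩

/-- **`H⁰(𝒳_v, 𝒪) = κ(v)` for the special fibre of a smooth proper model**, granting the
surjectivity half of the theorem on formal functions for the model,
`HasSurjectiveFormalFunctions 𝔪_v (𝒳 → Spec 𝓞_{K,v})` (Stacks Project, Tag 02OC):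
`isIso_appTop_snd_of_isReduced` applies, as `Γ(𝒳, 𝒪) = 𝓞_{K,v}` (`bijective_algebraMapΓ`), the
special fibre `𝒳_v = 𝒳 ×_{𝓞_{K,v}} κ(v)` is smooth, hence reduced, and non-empty
(`surjective_total_hom`), and the finite field `κ(v)` is perfect. [cite: StacksProject, Tag 02OC (Cohomology of Schemes, Theorem 30.20.5) and Tag 03H0 (More on Morphisms, proof of Theorem 37.53.4)] -/
theorem isIso_appTop_reductionAt
    (hFF : HasSurjectiveFormalFunctions (RingHom.ker (residueAt v)) 𝒳.total.hom) {n : ℕ}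
    (hX : IsSmoothProjective n X) (h : 𝒳.IsSmoothProper n) :
    IsIso (pullback.snd 𝒳.total.hom (Spec.map (CommRingCat.ofHom (residueAt v)))).appTop := by
  haveI := h.1
  haveI := h.2
  haveI := smoothOfRelativeDimension_isStableUnderBaseChange (n := n)
  haveI := 𝒳.surjective_total_hom hX h
  set g := pullback.snd 𝒳.total.hom (Spec.map (CommRingCat.ofHom (residueAt v))) with hg
  haveI : SmoothOfRelativeDimension n g := MorphismProperty.pullback_snd _ _ ‹_›
  haveI : IsReduced (pullback 𝒳.total.hom (Spec.map (CommRingCat.ofHom (residueAt v)))) :=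
    isReduced_of_smoothOfRelativeDimension g n
  haveI : Nonempty ↥(pullback 𝒳.total.hom (Spec.map (CommRingCat.ofHom (residueAt v)))) := by
    obtain ⟨y, -⟩ := g.surjective (Classical.arbitrary _)
    exact ⟨y⟩
  exact isIso_appTop_snd_of_isReduced 𝒳.total.hom (residueAt v) hFF (residueAt_surjective v)
    (𝒳.bijective_algebraMapΓ hX h)

/-- **Zariski's connectedness theorem for the special fibre of a smooth proper model**, granting
the surjectivity half of the theorem on formal functions for `𝒳 → Spec 𝓞_{K,v}` and `𝔪_v`
(Stacks Project, Tag 02OC): the reduction `𝒳 ×_{𝓞_{K,v}} κ(v)` of a smooth proper model of a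
smooth projective geometrically irreducible `X/K` is geometrically connected
(`geometricallyConnected_snd_of_isReduced`; Stacks Project, Tag 03H0, proof). [cite: StacksProject, Tags 02OC and 03H0 (Cohomology of Schemes, Theorem 30.20.5; More on Morphisms, Theorem 37.53.4)] -/
theorem geometricallyConnected_reductionAt
    (hFF : HasSurjectiveFormalFunctions (RingHom.ker (residueAt v)) 𝒳.total.hom) {n : ℕ}
    (hX : IsSmoothProjective n X) (h : 𝒳.IsSmoothProper n) :
    GeometricallyConnected
      (pullback.snd 𝒳.total.hom (Spec.map (CommRingCat.ofHom (residueAt v)))) := by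
  haveI := h.1
  haveI := h.2
  haveI := smoothOfRelativeDimension_isStableUnderBaseChange (n := n)
  haveI := 𝒳.surjective_total_hom hX h
  set g := pullback.snd 𝒳.total.hom (Spec.map (CommRingCat.ofHom (residueAt v))) with hg
  haveI : SmoothOfRelativeDimension n g := MorphismProperty.pullback_snd _ _ ‹_›
  haveI : IsReduced (pullback 𝒳.total.hom (Spec.map (CommRingCat.ofHom (residueAt v)))) :=
    isReduced_of_smoothOfRelativeDimension g n
  haveI : Nonempty ↥(pullback 𝒳.total.hom (Spec.map (CommRingCat.ofHom (residueAt v)))) := by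
    obtain ⟨y, -⟩ := g.surjective (Classical.arbitrary _)
    exact ⟨y⟩
  exact geometricallyConnected_snd_of_isReduced 𝒳.total.hom (residueAt v) hFF
    (residueAt_surjective v) (𝒳.bijective_algebraMapΓ hX h)

/-- **Conditional discharge of `geometricallyIrreducible_reductionAt` for one model from the
surjectivity half of the theorem on formal functions for that model**
(`HasSurjectiveFormalFunctions 𝔪_v (𝒳 → Spec 𝓞_{K,v})`, with `𝔪_v = ker (𝓞_{K,v} → κ(v))`; Stacks
Project, Tag 02OC, case `p = 0`, `𝓕 = 𝒪_𝒳`): the reduction `𝒳 ×_{𝓞_{K,v}} κ(v)` of a smooth proper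
model `𝒳` of a smooth projective geometrically irreducible `X/K` is geometrically irreducible —
geometrically connected by `geometricallyConnected_reductionAt` and smooth over `κ(v)`, hence
geometrically irreducible
(`geometricallyIrreducible_of_geometricallyConnected_of_smoothOfRelativeDimension`; Stacks
Project, Tag 056T). This is the form to use if the formal-functions input is established
only for smooth proper schemes over `𝓞_{K,v}` (e.g. from the finiteness of `H¹(𝒳, 𝒪_𝒳)`); the
unconditional discharge `geometricallyIrreducible_reductionAt_holds`
(`Literature/AlgebraicGeometry/Motives/GoodReductionZariskiProofs.lean`) instead establishes the
formal-functions input for a projective Chow cover of `𝒳` (see the module docstring).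
[cite: StacksProject, Tags 02OC, 03H0 and 056T (Cohomology of Schemes, Theorem 30.20.5; More on Morphisms, Theorem 37.53.4; Varieties, Lemma 33.25.4)] -/
theorem geometricallyIrreducible_reductionAt_of_hasSurjectiveFormalFunctions
    (hFF : HasSurjectiveFormalFunctions (RingHom.ker (residueAt v)) 𝒳.total.hom) :
    𝒳.geometricallyIrreducible_reductionAt := by
  intro n hX h
  haveI := 𝒳.geometricallyConnected_reductionAt hFF hX h
  haveI := h.1
  haveI := smoothOfRelativeDimension_isStableUnderBaseChange (n := n)
  haveI : SmoothOfRelativeDimension n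
      (pullback.snd 𝒳.total.hom (Spec.map (CommRingCat.ofHom (residueAt v)))) :=
    MorphismProperty.pullback_snd _ _ ‹_›
  exact geometricallyIrreducible_of_geometricallyConnected_of_smoothOfRelativeDimension
    (pullback.snd 𝒳.total.hom (Spec.map (CommRingCat.ofHom (residueAt v)))) n

end Literature.AlgebraicGeometry.Motives.IntegralModel

end
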